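import Literature.NumberTheory.EllipticCurves.NeumannSetzerCurves
import Literature.NumberTheory.EllipticCurves.SzpiroLocalDataProofs
import Literature.NumberTheory.EllipticCurves.Rank1Residual.X11RankOneCertificates.Minimality
import HarnessLib

/-!
# Neumann–Setzer curves: the conductor of the models `E₀(u)`, `E₁(u)` is the prime `p = u² + 64`

`Proofs` companion (theorems only: no definition, no named fact, no instance) of
`Literature.NumberTheory.EllipticCurves.NeumannSetzerCurves`. For `u ≡ 3 (mod 4)` with `p = u² + 64`
prime, the two Stein–Watkins models
`E₁(u) : y² + xy = x³ − (u+1)/4·x² − x` (`Δ = p`, `c₄ = p − 16`) and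
`E₀(u) : y² + xy = x³ − (u+1)/4·x² + 4x − u` (`Δ = −p²`, `c₄ = p − 256`)
are integral (`4 ∣ u + 1`), are ELLIPTIC, are GLOBAL MINIMAL models (no `q¹² ∣ Δ`), and have CONDUCTOR
`N = p`: at the place above `p`, `p ∣ Δ` and `p ∤ c₄` (as `p ∤ 16`, `p ∤ 256`: `p` is odd) give
multiplicative reduction, `f_p = 1` (Bombieri–Gubler 12.5.9 (b), tree theorem
`conductorExponent_eq_one_of_dvd_Δ_of_not_dvd_c₄`); at every other place `q ∤ Δ` gives `f_q = 0`
(12.5.9 (a), `conductorExponent_eq_zero_of_not_dvd_Δ`); `N = ∏ q^{f_q}`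
(`factorization_conductorNorm_primesEquiv_symm`). This is the elementary half («the curves have
conductor `p`») of Setzer's classification [Setzer1975] = [SteinWatkins2004, §1 (PDF p. 3): "Then `E₀`
has conductor `p`, and `E₁` … is isogeneous to `E₀` over `ℚ`"]; the hard half (prime conductor +
rational `2`-torsion ⇒ these models) is the tree theorem `Setzer1975_primeConductor_rationalTwoTorsion_holds`.

* `isElliptic_neumannSetzerCurve₁ / ₀` (`Δ ≠ 0`, unconditionally in `u`);
* `isGloballyMinimal_neumannSetzerCurve₁' / ₀'` (light Literature-side re-derivations of the
  summit-side `…Theorems.DepletionAtTwo.isGloballyMinimal_neumannSetzerCurve₁/₀`, which a Literature file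
  cannot import; same proof: `isGloballyMinimal_of_int_criterion`);
* `conductorNorm_neumannSetzerCurve₁`, `conductorNorm_neumannSetzerCurve₀` : `N = p`.

References: [SteinWatkins2004] §1; [Setzer1975]; [BombieriGubler2006] 12.5.9; [SilvermanAEC2009] VII.1 Rem. 1.1.
-/

open IsDedekindDomain WeierstrassCurve Rat.HeightOneSpectrum
  Literature.NumberTheory.EllipticCurves.Rank1Residual.X11RankOneCertificates

namespace Literature.NumberTheory.EllipticCurves

section NeumannSetzerConductor

variable {u : ℤ}

/-! ### Integer models and their invariants -/

/-- `(u + 1)/4` is an integer `m` for `u ≡ 3 (mod 4)` (`4m = u + 1`). [cite: SteinWatkins2004, §1 (PDF p. 3, u ≡ 3 (mod 4))] -/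
theorem NeumannSetzer.exists_four_mul_eq (hu : u % 4 = 3) : ∃ m : ℤ, 4 * m = u + 1 :=
  ⟨(u + 1) / 4, Int.mul_ediv_cancel' (by omega)⟩

/-- The integer model `[1, −m, 0, −1, 0]` base-changes to `E₁(u)` when `4m = u + 1`.
[cite: SteinWatkins2004, §1 eq. (1) (PDF p. 3)] -/
theorem NeumannSetzer.baseChange_intModel₁ {m : ℤ} (hm : 4 * m = u + 1) :
    (⟨1, -m, 0, -1, 0⟩ : WeierstrassCurve ℤ).baseChange ℚ = neumannSetzerCurve₁ u := by
  have hmq : (m : ℚ) = ((u : ℚ) + 1) / 4 := by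
    have : (4 : ℚ) * m = u + 1 := by exact_mod_cast hm
    linarith
  ext <;> simp [baseChange, neumannSetzerCurve₁, hmq]

/-- The integer model `[1, −m, 0, 4, −u]` base-changes to `E₀(u)` when `4m = u + 1`.
[cite: SteinWatkins2004, §1 eq. (1) (PDF p. 3)] -/
theorem NeumannSetzer.baseChange_intModel₀ {m : ℤ} (hm : 4 * m = u + 1) :
    (⟨1, -m, 0, 4, -u⟩ : WeierstrassCurve ℤ).baseChange ℚ = neumannSetzerCurve₀ u := by
  have hmq : (m : ℚ) = ((u : ℚ) + 1) / 4 := by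
    have : (4 : ℚ) * m = u + 1 := by exact_mod_cast hm
    linarith
  ext <;> simp [baseChange, neumannSetzerCurve₀, hmq]

/-- `Δ[1, −m, 0, −1, 0] = u² + 64` for `4m = u + 1`. [cite: SteinWatkins2004, §1 (PDF p. 3, "Δ = p")] -/
theorem NeumannSetzer.Δ_intModel₁ {m : ℤ} (hm : 4 * m = u + 1) :
    (⟨1, -m, 0, -1, 0⟩ : WeierstrassCurve ℤ).Δ = u ^ 2 + 64 := by
  have hu : u = 4 * m - 1 := by linarith
  subst hu
  simp only [WeierstrassCurve.Δ, WeierstrassCurve.b₂, WeierstrassCurve.b₄, WeierstrassCurve.b₆,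
    WeierstrassCurve.b₈]
  ring

/-- `c₄[1, −m, 0, −1, 0] = u² + 48` (`= p − 16`) for `4m = u + 1`. [cite: SteinWatkins2004, §1 (PDF p. 3, "c₄ = p − 16")] -/
theorem NeumannSetzer.c₄_intModel₁ {m : ℤ} (hm : 4 * m = u + 1) :
    (⟨1, -m, 0, -1, 0⟩ : WeierstrassCurve ℤ).c₄ = u ^ 2 + 48 := by
  have hu : u = 4 * m - 1 := by linarith
  subst hu
  simp only [WeierstrassCurve.c₄, WeierstrassCurve.b₂, WeierstrassCurve.b₄]
  ring

/-- `Δ[1, −m, 0, 4, −u] = −(u² + 64)²` for `4m = u + 1`. [cite: SteinWatkins2004, §1 (PDF p. 3, "Δ = −p²")] -/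
theorem NeumannSetzer.Δ_intModel₀ {m : ℤ} (hm : 4 * m = u + 1) :
    (⟨1, -m, 0, 4, -u⟩ : WeierstrassCurve ℤ).Δ = -(u ^ 2 + 64) ^ 2 := by
  have hu : u = 4 * m - 1 := by linarith
  subst hu
  simp only [WeierstrassCurve.Δ, WeierstrassCurve.b₂, WeierstrassCurve.b₄, WeierstrassCurve.b₆,
    WeierstrassCurve.b₈]
  ring

/-- `c₄[1, −m, 0, 4, −u] = u² − 192` (`= p − 256`) for `4m = u + 1`. [cite: SteinWatkins2004, §1 (PDF p. 3, "c₄ = p − 256")] -/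
theorem NeumannSetzer.c₄_intModel₀ {m : ℤ} (hm : 4 * m = u + 1) :
    (⟨1, -m, 0, 4, -u⟩ : WeierstrassCurve ℤ).c₄ = u ^ 2 - 192 := by
  have hu : u = 4 * m - 1 := by linarith
  subst hu
  simp only [WeierstrassCurve.c₄, WeierstrassCurve.b₂, WeierstrassCurve.b₄]
  ring

/-! ### Ellipticity and global minimality -/

/-- `E₁(u)` is an elliptic curve: `Δ = u² + 64 > 0`. [cite: SteinWatkins2004, §1 (PDF p. 3)] -/
theorem isElliptic_neumannSetzerCurve₁ (u : ℤ) : (neumannSetzerCurve₁ u).IsElliptic := by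
  rw [WeierstrassCurve.isElliptic_iff, Δ_neumannSetzerCurve₁, isUnit_iff_ne_zero]
  positivity

/-- `E₀(u)` is an elliptic curve: `Δ = −(u² + 64)² ≠ 0`. [cite: SteinWatkins2004, §1 (PDF p. 3)] -/
theorem isElliptic_neumannSetzerCurve₀ (u : ℤ) : (neumannSetzerCurve₀ u).IsElliptic := by
  rw [WeierstrassCurve.isElliptic_iff, Δ_neumannSetzerCurve₀, isUnit_iff_ne_zero]
  exact neg_ne_zero.mpr (by positivity)

/-- A prime has no `12`-th power prime divisor, nor does its square. [folklore] -/
private theorem NeumannSetzer.not_pow_twelve_dvd_sq_of_prime {N : ℕ} (hN : N.Prime) (q : ℕ) (hq : q.Prime) :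
    ¬ (q : ℤ) ^ 12 ∣ (N : ℤ) ^ 2 := by
  intro h
  have hqN : (q : ℤ) ∣ (N : ℤ) ^ 2 := dvd_trans (dvd_pow_self _ (by norm_num)) h
  have hqN' : q ∣ N ^ 2 := by exact_mod_cast hqN
  have hqeq : q = N := (Nat.prime_dvd_prime_iff_eq hq hN).mp (hq.dvd_of_dvd_pow hqN')
  subst hqeq
  have h' : q ^ 12 ∣ q ^ 2 := by exact_mod_cast h
  have := (Nat.pow_dvd_pow_iff_le_right hq.one_lt).mp h'
  omega

/-- **`E₁(u)` is a global minimal model** (`Δ = p` prime: no `q¹² ∣ Δ`; Silverman VII.1 Rem. 1.1). Light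
Literature-side twin of the summit-side `DepletionAtTwo.isGloballyMinimal_neumannSetzerCurve₁`.
[cite: SilvermanAEC2009, VII.1 Remark 1.1] [cite: SteinWatkins2004, §1 (PDF p. 3, "Δ = p")] -/
theorem isGloballyMinimal_neumannSetzerCurve₁' {N : ℕ} (hN : N.Prime) (hNu : (N : ℤ) = u ^ 2 + 64)
    (hu : u % 4 = 3) : (neumannSetzerCurve₁ u).IsGloballyMinimal := by
  obtain ⟨m, hm⟩ := NeumannSetzer.exists_four_mul_eq hu
  have hW : neumannSetzerCurve₁ u = (⟨((1 : ℤ) : ℚ), ((-m : ℤ) : ℚ), ((0 : ℤ) : ℚ), ((-1 : ℤ) : ℚ),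
      ((0 : ℤ) : ℚ)⟩ : WeierstrassCurve ℚ) := by
    rw [← NeumannSetzer.baseChange_intModel₁ hm]
    ext <;> simp [baseChange]
  rw [hW]
  refine isGloballyMinimal_of_int_criterion 1 (-m) 0 (-1) 0 fun q hq hboth ↦ ?_
  obtain ⟨h12, -⟩ := hboth
  have hΔ : discOf [1, -m, 0, -1, 0] = (N : ℤ) := by
    rw [hNu, show u = 4 * m - 1 by linarith]
    simp only [discOf, invariants]
    ring
  rw [hΔ] at h12
  exact NeumannSetzer.not_pow_twelve_dvd_sq_of_prime hN q hq (dvd_trans h12 (dvd_pow_self _ (by norm_num)))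

/-- **`E₀(u)` is a global minimal model** (`Δ = −p²` with `p` prime: no `q¹² ∣ Δ`). Light Literature-side
twin of the summit-side `DepletionAtTwo.isGloballyMinimal_neumannSetzerCurve₀`.
[cite: SilvermanAEC2009, VII.1 Remark 1.1] [cite: SteinWatkins2004, §1 (PDF p. 3, "Δ = −p²")] -/
theorem isGloballyMinimal_neumannSetzerCurve₀' {N : ℕ} (hN : N.Prime) (hNu : (N : ℤ) = u ^ 2 + 64)
    (hu : u % 4 = 3) : (neumannSetzerCurve₀ u).IsGloballyMinimal := by
  obtain ⟨m, hm⟩ := NeumannSetzer.exists_four_mul_eq hu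
  have hW : neumannSetzerCurve₀ u = (⟨((1 : ℤ) : ℚ), ((-m : ℤ) : ℚ), ((0 : ℤ) : ℚ), ((4 : ℤ) : ℚ),
      ((-u : ℤ) : ℚ)⟩ : WeierstrassCurve ℚ) := by
    rw [← NeumannSetzer.baseChange_intModel₀ hm]
    ext <;> simp [baseChange]
  rw [hW]
  refine isGloballyMinimal_of_int_criterion 1 (-m) 0 4 (-u) fun q hq hboth ↦ ?_
  obtain ⟨h12, -⟩ := hboth
  have hΔ : discOf [1, -m, 0, 4, -u] = -((N : ℤ) ^ 2) := by
    rw [hNu, show u = 4 * m - 1 by linarith]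
    simp only [discOf, invariants]
    ring
  rw [hΔ, dvd_neg] at h12
  exact NeumannSetzer.not_pow_twelve_dvd_sq_of_prime hN q hq h12

/-! ### The conductor -/

/-- `p = u² + 64` prime is odd, so `p ∤ 2^k`. [folklore] -/
private theorem NeumannSetzer.not_dvd_two_pow {N : ℕ} (hN : N.Prime) (hNu : (N : ℤ) = u ^ 2 + 64) (k : ℕ) :
    ¬ (N : ℤ) ∣ 2 ^ k := by
  intro h
  have hodd : Odd u := odd_of_prime_sq_add_sixty_four hN hNu
  have hN2 : (N : ℤ) ∣ 2 := by
    have hp : Prime (N : ℤ) := Nat.prime_iff_prime_int.mp hN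
    exact hp.dvd_of_dvd_pow h
  have hN2' : N ∣ 2 := by exact_mod_cast hN2
  have hN2'' : N = 2 := (Nat.prime_dvd_prime_iff_eq hN Nat.prime_two).mp hN2'
  subst hN2''
  obtain ⟨k, rfl⟩ := hodd
  have : (2 : ℤ) = (2 * k + 1) ^ 2 + 64 := by exact_mod_cast hNu
  nlinarith [sq_nonneg (2 * k + 1)]

/-- **The conductor of `E₁(u)` is `p = u² + 64`** (`u ≡ 3 (mod 4)`, `p` prime): multiplicative reduction
at `p` (`p ∣ Δ = p`, `p ∤ c₄ = p − 16`), good reduction elsewhere (`q ∤ Δ`).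
[cite: SteinWatkins2004, §1 (PDF p. 3, "E₀ has conductor p … E₁ … is isogenous to E₀")]
[cite: BombieriGubler2006, 12.5.9 (a),(b)] -/
theorem conductorNorm_neumannSetzerCurve₁ {N : ℕ} (hN : N.Prime) (hNu : (N : ℤ) = u ^ 2 + 64)
    (hu : u % 4 = 3) : (neumannSetzerCurve₁ u).conductorNorm ℤ = N := by
  obtain ⟨m, hm⟩ := NeumannSetzer.exists_four_mul_eq hu
  set W₀ : WeierstrassCurve ℤ := ⟨1, -m, 0, -1, 0⟩ with hW₀
  have hW : W₀.baseChange ℚ = neumannSetzerCurve₁ u := NeumannSetzer.baseChange_intModel₁ hm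
  have hΔ : W₀.Δ = N := by rw [hNu]; exact NeumannSetzer.Δ_intModel₁ hm
  have hc₄ : W₀.c₄ = (N : ℤ) - 16 := by rw [hNu, NeumannSetzer.c₄_intModel₁ hm]; ring
  haveI : (W₀.baseChange ℚ).IsElliptic := by rw [hW]; exact isElliptic_neumannSetzerCurve₁ u
  rw [← hW]
  -- minimality at every place of `ℤ`: `q¹² ∤ Δ = N`
  have hmin : ∀ v : HeightOneSpectrum ℤ, (W₀.baseChange ℚ).IsMinimalAt v := fun v ↦
    isMinimalAt_baseChange_int_of_not_pow_dvd_Δ (by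
      rw [hΔ]
      intro h
      have hq : (Rat.HeightOneSpectrum.natGenerator v).Prime := (Rat.HeightOneSpectrum.primesEquiv v).2
      exact NeumannSetzer.not_pow_twelve_dvd_sq_of_prime hN _ hq
        (dvd_trans h (dvd_pow_self _ (by norm_num))))
  refine Nat.eq_of_factorization_eq (conductorNorm_pos_holds _).ne' hN.ne_zero fun p => ?_
  by_cases hp : p.Prime
  swap
  · rw [Nat.factorization_eq_zero_of_not_prime _ hp, Nat.factorization_eq_zero_of_not_prime _ hp]
  rw [show p = ((⟨p, hp⟩ : Nat.Primes) : ℕ) from rfl, factorization_conductorNorm_primesEquiv_symm,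
    hN.factorization]
  set v := (Rat.HeightOneSpectrum.primesEquiv (R := ℤ)).symm ⟨p, hp⟩ with hv
  have hgen : Rat.HeightOneSpectrum.natGenerator v = p :=
    Literature.NumberTheory.EllipticCurves.Rat.natGenerator_primesEquiv_symm ⟨p, hp⟩
  by_cases hpN : p = N
  · -- the multiplicative place
    have h1 : (W₀.baseChange ℚ).conductorExponent v = 1 := by
      refine conductorExponent_eq_one_of_dvd_Δ_of_not_dvd_c₄ (hmin v) ?_ ?_
      · rw [hgen, hpN, hΔ]
      · rw [hgen, hpN, hc₄]
        intro h
        have h16 : (N : ℤ) ∣ 16 := by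
          have := dvd_sub (dvd_refl (N : ℤ)) h
          simpa using this
        exact NeumannSetzer.not_dvd_two_pow hN hNu 4 (by norm_num at h16 ⊢; exact h16)
    rw [h1]
    simp [hpN]
  · -- a good place
    have h0 : (W₀.baseChange ℚ).conductorExponent v = 0 := by
      refine conductorExponent_eq_zero_of_not_dvd_Δ (hmin v) ?_
      rw [hgen, hΔ]
      intro h
      exact hpN ((Nat.prime_dvd_prime_iff_eq hp hN).mp (by exact_mod_cast h))
    rw [h0]
    simp [Ne.symm hpN]

/-- **The conductor of `E₀(u)` is `p = u² + 64`** (`u ≡ 3 (mod 4)`, `p` prime): multiplicative reduction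
at `p` (`p ∣ Δ = −p²`, `p ∤ c₄ = p − 256`), good reduction elsewhere.
[cite: SteinWatkins2004, §1 (PDF p. 3, "Then E₀ has conductor p")] [cite: BombieriGubler2006, 12.5.9 (a),(b)] -/
theorem conductorNorm_neumannSetzerCurve₀ {N : ℕ} (hN : N.Prime) (hNu : (N : ℤ) = u ^ 2 + 64)
    (hu : u % 4 = 3) : (neumannSetzerCurve₀ u).conductorNorm ℤ = N := by
  obtain ⟨m, hm⟩ := NeumannSetzer.exists_four_mul_eq hu
  set W₀ : WeierstrassCurve ℤ := ⟨1, -m, 0, 4, -u⟩ with hW₀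
  have hW : W₀.baseChange ℚ = neumannSetzerCurve₀ u := NeumannSetzer.baseChange_intModel₀ hm
  have hΔ : W₀.Δ = -((N : ℤ) ^ 2) := by rw [hNu]; exact NeumannSetzer.Δ_intModel₀ hm
  have hc₄ : W₀.c₄ = (N : ℤ) - 256 := by rw [hNu, NeumannSetzer.c₄_intModel₀ hm]; ring
  haveI : (W₀.baseChange ℚ).IsElliptic := by rw [hW]; exact isElliptic_neumannSetzerCurve₀ u
  rw [← hW]
  have hmin : ∀ v : HeightOneSpectrum ℤ, (W₀.baseChange ℚ).IsMinimalAt v := fun v ↦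
    isMinimalAt_baseChange_int_of_not_pow_dvd_Δ (by
      rw [hΔ, dvd_neg]
      exact NeumannSetzer.not_pow_twelve_dvd_sq_of_prime hN _ (Rat.HeightOneSpectrum.primesEquiv v).2)
  refine Nat.eq_of_factorization_eq (conductorNorm_pos_holds _).ne' hN.ne_zero fun p => ?_
  by_cases hp : p.Prime
  swap
  · rw [Nat.factorization_eq_zero_of_not_prime _ hp, Nat.factorization_eq_zero_of_not_prime _ hp]
  rw [show p = ((⟨p, hp⟩ : Nat.Primes) : ℕ) from rfl, factorization_conductorNorm_primesEquiv_symm,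
    hN.factorization]
  set v := (Rat.HeightOneSpectrum.primesEquiv (R := ℤ)).symm ⟨p, hp⟩ with hv
  have hgen : Rat.HeightOneSpectrum.natGenerator v = p :=
    Literature.NumberTheory.EllipticCurves.Rat.natGenerator_primesEquiv_symm ⟨p, hp⟩
  by_cases hpN : p = N
  · have h1 : (W₀.baseChange ℚ).conductorExponent v = 1 := by
      refine conductorExponent_eq_one_of_dvd_Δ_of_not_dvd_c₄ (hmin v) ?_ ?_
      · rw [hgen, hpN, hΔ, dvd_neg]
        exact dvd_pow_self _ (by norm_num)
      · rw [hgen, hpN, hc₄]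
        intro h
        have h256 : (N : ℤ) ∣ 256 := by
          have := dvd_sub (dvd_refl (N : ℤ)) h
          simpa using this
        exact NeumannSetzer.not_dvd_two_pow hN hNu 8 (by norm_num at h256 ⊢; exact h256)
    rw [h1]
    simp [hpN]
  · have h0 : (W₀.baseChange ℚ).conductorExponent v = 0 := by
      refine conductorExponent_eq_zero_of_not_dvd_Δ (hmin v) ?_
      rw [hgen, hΔ, dvd_neg]
      intro h
      have hp' : Prime (p : ℤ) := Nat.prime_iff_prime_int.mp hp
      have hpN' : (p : ℤ) ∣ (N : ℤ) := hp'.dvd_of_dvd_pow h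
      exact hpN ((Nat.prime_dvd_prime_iff_eq hp hN).mp (by exact_mod_cast hpN'))
    rw [h0]
    simp [Ne.symm hpN]

/-- The conductor of `E₁(u)` is prime (`= u² + 64`). [cite: SteinWatkins2004, §1 (PDF p. 3)] -/
theorem prime_conductorNorm_neumannSetzerCurve₁ {N : ℕ} (hN : N.Prime) (hNu : (N : ℤ) = u ^ 2 + 64)
    (hu : u % 4 = 3) : ((neumannSetzerCurve₁ u).conductorNorm ℤ).Prime := by
  rw [conductorNorm_neumannSetzerCurve₁ hN hNu hu]; exact hN

/-- The conductor of `E₀(u)` is prime (`= u² + 64`). [cite: SteinWatkins2004, §1 (PDF p. 3)] -/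
theorem prime_conductorNorm_neumannSetzerCurve₀ {N : ℕ} (hN : N.Prime) (hNu : (N : ℤ) = u ^ 2 + 64)
    (hu : u % 4 = 3) : ((neumannSetzerCurve₀ u).conductorNorm ℤ).Prime := by
  rw [conductorNorm_neumannSetzerCurve₀ hN hNu hu]; exact hN

end NeumannSetzerConductor

end Literature.NumberTheory.EllipticCurves
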